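import Summits.RiemannHypothesis.RiemannHypothesis.Theorems.PfPersistenceEdgeLawDini
import Summits.RiemannHypothesis.RiemannHypothesis.Theorems.PfPersistenceMarkovCoreWindowStability
import HarnessLib

/-!
# The closed dilation virial of a window function: explicit pole response, identification with
# Bombieri's virial on tests, and `L²`-continuity (pub-rhpf, theory-1 gen 9; helper for crux
# `EvenSectorBarta.EvenOneSignedWindows`, item stmt-RiemannHypothesis-19953; RH-free)

**mechanism/rigidity campaign; no RH claims.**  Companion text:
`run/shared/lean/pub/pub-rhpf/pub-rhpf-theory-1/THEORY-EDGE-9.md`.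

The small-window edge law (`PfPersistenceProfileDeriv`, `PfPersistenceEdgeLawDini`) is stated with
the DILATION VIRIAL `weilSmallWindowVirial a u = (d/dη) P(ũ_η)|₀ − ∫₀^∞ (tρ)'(s) D_s(ũ) ds` of a
ground state, whose pole part is an abstract `deriv`. For the DANSKIN form of the edge law
(`PfPersistenceWindowDanskin`: the one-sided window derivatives of the bottom are `−max V/a` and
`−min V/a` over the ground states) the virial must be a CONTINUOUS FUNCTIONAL on the form-domain
ball. This file supplies that:

* `hasDerivAt_integral_mul_kernel`, `hasDerivAt_integral_weilDilate_mul_kernel`: the pairings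
  `η ↦ ∫ f_η(t) k(t/2) dt` (`f_η = weilDilate η f`, `f ∈ L²` vanishing off a window, `k ∈ C¹`) have
  the EXPLICIT derivative `−∫ f(x) (x/2) k'(x/2) dx − ½ ∫ f(x) k(x/2) dx` at `η = 0`
  (differentiation under the integral sign; the existence half is `PfPersistencePoleDeriv`).
* `weilPoleResponse f` — the explicit `η`-derivative of the pole form `P(f_η)` at `0`
  (`hasDerivAt_weilPoleForm_weilDilate`): `4⟪A, A' − A/2⟫ − 4⟪B, B' − B/2⟫` with
  `A = ∫ f cosh(x/2)`, `B = ∫ f sinh(x/2)`, `A' = −∫ f (x/2) sinh(x/2)`, `B' = −∫ f (x/2) cosh(x/2)`,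
  `⟪z, w⟫ = Re (w z̄)`.
* `weilFormVirial f = weilPoleResponse f − ∫₀^∞ (tρ)'(s) D_s(f) ds` — the CLOSED DILATION VIRIAL,
  defined for every `f`; `hasDerivAt_weilClosedForm_weilDilate`: it is the `η`-derivative at `0` of
  the closed form `P + 𝓔_A − M_A‖·‖²` along the dilation orbit of every finite-energy `L²` function
  vanishing off a window of radius `b < ½ log 2` (no prime length below the support diameter);
  `weilSmallWindowVirial_eq_weilFormVirial`: `weilSmallWindowVirial a u = weilFormVirial ũ`;
  `weilDilationVirial_eq_weilFormVirial`: on test functions of such a window it is Bombieri's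
  `weilDilationVirial g = Re W(D(g ⋆ g̃))` (uniqueness of derivatives against
  `hasDerivAt_weilDilationProfile_of_isWeilTest`) — so `weilFormVirial` is the closed extension of the
  virial from `C_c^∞` to the form domain.
* `tendsto_weilPoleResponse_of_window`, `tendsto_weilFormVirial_of_window` (CONTINUITY): along an
  `L²`-convergent sequence of `L²` functions living on a fixed window (with bounded norms) the pole
  response and the closed virial converge (pairings with continuous weights; dominated convergence
  with `|(tρ)'(s)| ≤ C e^{-s/4}` and `D_s ≤ 4‖·‖²`).

All statements are PROVED (sorry-free) and are facts about every windowed form of this type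
(structure, not arithmetic).

References: T. Kato, *Perturbation Theory for Linear Operators* (1966), VII §4 (forms depending on
a parameter); E. Bombieri, Rend. Mat. Acc. Lincei (9) 11 (2000) 183–233, §4 (proof of Thm 5: the
dilation); J. M. Danskin, SIAM J. Appl. Math. 14 (1966) 641–664 (directional derivatives of minima).
-/

set_option linter.dupNamespace false

noncomputable section

open MeasureTheory Set Filter Metric
open scoped Topology RealInnerProductSpace

namespace Summit.RiemannHypothesis.RiemannHypothesis.Theorems.PfPersistence

open Literature.NumberTheory.LFunctions
open Summit.RiemannHypothesis.RiemannHypothesis.Theorems.WeilWindowFlowWindowLipschitz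
open Summit.RiemannHypothesis.RiemannHypothesis.Theorems.WeilGroundStateMarkovPart
  (tendsto_weilIncrement_of_tendsto)
open Summit.RiemannHypothesis.RiemannHypothesis.Theorems.OddSector
  (tendsto_integral_mul_ofReal_of_window tendsto_weilPoleForm_of_window)

/-! ## §1 Parameter integrals over a window: the explicit derivative -/

/-- **Differentiation under the integral sign, explicit form.** For `f ∈ L²` vanishing at every
`|x| ≥ b` and `k : ℝ → ℝ` with continuous derivative `k'`, the parameter integral
`η ↦ ∫ f(x) k(x/2 · (1+η)⁻¹) dx` has derivative `∫ f(x) · (−(x/2) k'(x/2)) dx` at `η = 0`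
(dominated convergence; the existence statement is `differentiableAt_integral_mul_kernel`).
[folklore] -/
theorem hasDerivAt_integral_mul_kernel {f : ℝ → ℂ} {b : ℝ} (hf : MemLp f 2)
    (hfs : ∀ x, b ≤ |x| → f x = 0) {k k' : ℝ → ℝ} (hk : ∀ y, HasDerivAt k (k' y) y)
    (hk' : Continuous k') :
    HasDerivAt (fun η : ℝ ↦ ∫ x, f x * (k (x / 2 * (1 + η)⁻¹) : ℂ))
      (∫ x, f x * ((-(x / 2) * k' (x / 2) : ℝ) : ℂ)) 0 := by
  have hkc : Continuous k := continuous_iff_continuousAt.2 fun y ↦ (hk y).continuousAt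
  have hfi : Integrable f := integrable_of_memLp_of_window hf hfs
  obtain ⟨K, hK⟩ := isCompact_Icc.exists_bound_of_continuousOn (hk'.continuousOn (s := Icc (-b) b))
  set K' : ℝ := max K 0 with hK'def
  have hK' : ∀ y ∈ Icc (-b) b, |k' y| ≤ K' := fun y hy ↦
    (Real.norm_eq_abs _ ▸ hK y hy).trans (le_max_left _ _)
  have hK0 : 0 ≤ K' := le_max_right _ _
  set F : ℝ → ℝ → ℂ := fun η x ↦ f x * (k (x / 2 * (1 + η)⁻¹) : ℂ) with hF
  set F' : ℝ → ℝ → ℂ :=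
    fun η x ↦ f x * ((k' (x / 2 * (1 + η)⁻¹) * (x / 2 * (-1 / (1 + η) ^ 2)) : ℝ) : ℂ) with hF'
  have hFm : ∀ η, AEStronglyMeasurable (F η) volume := fun η ↦
    hf.1.mul (Complex.continuous_ofReal.comp (hkc.comp ((continuous_id.div_const 2).mul
      continuous_const))).aestronglyMeasurable
  have hFint : ∀ η, Integrable (F η) := fun η ↦ by
    have h1 : IntegrableOn (F η) (Icc (-b) b) :=
      (hfi.integrableOn).mul_continuousOn ((Complex.continuous_ofReal.comp (hkc.comp
        ((continuous_id.div_const 2).mul continuous_const))).continuousOn) isCompact_Icc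
    refine h1.integrable_of_ae_notMem_eq_zero (Eventually.of_forall fun x hx ↦ ?_)
    simp only [hF, hfs x (not_le.1 fun h ↦ hx (abs_le.1 h)).le, zero_mul]
  have hF'm : AEStronglyMeasurable (F' 0) volume :=
    hf.1.mul (Complex.continuous_ofReal.comp ((hk'.comp ((continuous_id.div_const 2).mul
      continuous_const)).mul ((continuous_id.div_const 2).mul continuous_const))).aestronglyMeasurable
  have h_bound : ∀ᵐ x ∂volume, ∀ η ∈ ball (0 : ℝ) (1 / 2), ‖F' η x‖ ≤ ‖f x‖ * (K' * (2 * |b|)) :=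
    Eventually.of_forall fun x η hη ↦ by
      have hη' : |η| < 1 / 2 := by simpa [Real.dist_eq] using hη
      have hc1 : 1 / 2 < 1 + η := by linarith [(abs_lt.1 hη').1]
      have hc : 0 < 1 + η := by linarith
      by_cases hx : b ≤ |x|
      · simp [hF', hfs x hx]
      · have hxb : |x| < b := not_le.1 hx
        have hb : 0 < b := (abs_nonneg x).trans_lt hxb
        have hinv : (1 + η)⁻¹ ≤ 2 := by
          rw [inv_le_comm₀ hc (by norm_num)]
          linarith
        have hy : x / 2 * (1 + η)⁻¹ ∈ Icc (-b) b := by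
          rw [mem_Icc, ← abs_le]
          rw [abs_mul, abs_of_pos (inv_pos.2 hc), abs_div, abs_two]
          nlinarith [abs_nonneg x, inv_pos.2 hc]
        have h1 : |k' (x / 2 * (1 + η)⁻¹)| ≤ K' := hK' _ hy
        have hsq : ((1 + η) ^ 2)⁻¹ ≤ 4 := by
          rw [inv_le_comm₀ (by positivity) (by norm_num)]
          nlinarith
        have h2 : |x / 2 * (-1 / (1 + η) ^ 2)| ≤ 2 * |b| := by
          rw [abs_mul, abs_div, abs_two, abs_div, abs_neg, abs_one, abs_of_pos (by positivity :
            (0:ℝ) < (1 + η) ^ 2), one_div, abs_of_pos hb]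
          nlinarith [abs_nonneg x, inv_pos.2 (by positivity : (0:ℝ) < (1 + η) ^ 2)]
        have hn : ‖F' η x‖ = ‖f x‖ * (|k' (x / 2 * (1 + η)⁻¹)| * |x / 2 * (-1 / (1 + η) ^ 2)|) := by
          simp only [hF', norm_mul, Complex.norm_real, Real.norm_eq_abs, Complex.ofReal_mul, abs_mul]
        rw [hn]
        exact mul_le_mul_of_nonneg_left (mul_le_mul h1 h2 (abs_nonneg _) hK0) (norm_nonneg _)
  have h_diff : ∀ᵐ x ∂volume, ∀ η ∈ ball (0 : ℝ) (1 / 2),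
      HasDerivAt (fun η ↦ F η x) (F' η x) η :=
    Eventually.of_forall fun x η hη ↦ by
      have hη' : |η| < 1 / 2 := by simpa [Real.dist_eq] using hη
      have hc : 0 < 1 + η := by linarith [(abs_lt.1 hη').1]
      have h1 : HasDerivAt (fun η : ℝ ↦ (1 + η)⁻¹) (-(1 : ℝ) / (1 + η) ^ 2) η :=
        ((hasDerivAt_id' η).const_add 1).inv hc.ne'
      have h2 := h1.const_mul (x / 2)
      have h3 := (((hk _).comp η h2).ofReal_comp).const_mul (f x)
      simpa only [hF, hF', Function.comp_def] using h3
  have key := hasDerivAt_integral_of_dominated_loc_of_deriv_le (μ := volume) (F := F) (F' := F')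
    (x₀ := 0) (bound := fun x ↦ ‖f x‖ * (K' * (2 * |b|)))
    (ball_mem_nhds (0 : ℝ) (by norm_num : (0 : ℝ) < 1 / 2)) (Eventually.of_forall hFm) (hFint 0)
    hF'm h_bound (hfi.norm.mul_const _) h_diff
  refine key.2.congr_deriv (integral_congr_ae (Eventually.of_forall fun x ↦ ?_))
  simp only [hF', add_zero, inv_one, mul_one, one_pow, div_one]
  push_cast
  ring

/-- **The pole pairings along the dilation orbit have an explicit derivative.** For `f ∈ L²`
vanishing at every `|x| ≥ b` and `k ∈ C¹`:
`(d/dη)|₀ ∫ f_η(t) k(t/2) dt = ∫ f(x)(−(x/2) k'(x/2)) dx − ½ ∫ f(x) k(x/2) dx`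
(`∫ f_η k(t/2) = (1+η)^{1/2} (1+η)⁻¹ ∫ f(x) k(x/(2(1+η))) dx`, `integral_weilDilate_mul_kernel`).
[folklore] -/
theorem hasDerivAt_integral_weilDilate_mul_kernel {f : ℝ → ℂ} {b : ℝ} (hf : MemLp f 2)
    (hfs : ∀ x, b ≤ |x| → f x = 0) {k k' : ℝ → ℝ} (hk : ∀ y, HasDerivAt k (k' y) y)
    (hk' : Continuous k') :
    HasDerivAt (fun η : ℝ ↦ ∫ t, weilDilate η f t * (k (t / 2) : ℂ))
      ((∫ x, f x * ((-(x / 2) * k' (x / 2) : ℝ) : ℂ)) -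
        (1 / 2 : ℂ) * ∫ x, f x * (k (x / 2) : ℂ)) 0 := by
  have h1 : HasDerivAt (fun η : ℝ ↦ 1 + η) 1 0 := by
    simpa using (hasDerivAt_id (0 : ℝ)).const_add 1
  have hsqrt : HasDerivAt (fun η : ℝ ↦ Real.sqrt (1 + η)) (1 / 2) 0 := by
    have h := h1.sqrt (by norm_num)
    norm_num at h
    exact h
  have hpre : HasDerivAt (fun η : ℝ ↦ ((Real.sqrt (1 + η) : ℝ) : ℂ)) (((1 / 2 : ℝ) : ℝ) : ℂ) 0 :=
    hsqrt.ofReal_comp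
  have hinv : HasDerivAt (fun η : ℝ ↦ (1 + η)⁻¹) (-1) 0 := by
    have h := h1.inv (by norm_num)
    norm_num at h
    exact h
  have hJ := hasDerivAt_integral_mul_kernel hf hfs hk hk'
  have hG := hpre.mul (hinv.smul hJ)
  have hev : (fun η : ℝ ↦ ∫ t, weilDilate η f t * (k (t / 2) : ℂ)) =ᶠ[𝓝 0] fun η ↦
      (Real.sqrt (1 + η) : ℂ) * ((1 + η)⁻¹ • ∫ x, f x * (k (x / 2 * (1 + η)⁻¹) : ℂ)) := by
    filter_upwards [Ioi_mem_nhds (show (-1 : ℝ) < 0 by norm_num)] with η hη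
    exact integral_weilDilate_mul_kernel f k hη
  refine (hG.congr_of_eventuallyEq hev).congr_deriv ?_
  simp only [Pi.smul_apply', add_zero, Real.sqrt_one, inv_one, one_smul, mul_one,
    Complex.ofReal_one, one_mul, neg_one_smul]
  push_cast
  ring

/-! ## §2 The pole response -/

/-- The **pole response** of a window function: the explicit `η`-derivative at `0` of the pole form
`P(f_η) = 2|∫ f_η cosh(t/2)|² − 2|∫ f_η sinh(t/2)|²` along the dilation orbit
(`hasDerivAt_weilPoleForm_weilDilate`): `4⟪A, A' − A/2⟫ − 4⟪B, B' − B/2⟫`, `⟪z, w⟫ = Re (w z̄)`,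
`A = ∫ f cosh(x/2)`, `B = ∫ f sinh(x/2)`, `A' = −∫ f(x)(x/2) sinh(x/2)`, `B' = −∫ f(x)(x/2) cosh(x/2)`.
A continuous quadratic functional of `f ∈ L²` of a window. [cite: Kato1966, VII §4 (forms depending on a parameter)] -/
def weilPoleResponse (f : ℝ → ℂ) : ℝ :=
  2 * (2 * ⟪(∫ x, f x * (Real.cosh (x / 2) : ℂ)),
      (∫ x, f x * ((-(x / 2) * Real.sinh (x / 2) : ℝ) : ℂ)) -
        (1 / 2 : ℂ) * (∫ x, f x * (Real.cosh (x / 2) : ℂ))⟫) -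
    2 * (2 * ⟪(∫ x, f x * (Real.sinh (x / 2) : ℂ)),
      (∫ x, f x * ((-(x / 2) * Real.cosh (x / 2) : ℝ) : ℂ)) -
        (1 / 2 : ℂ) * (∫ x, f x * (Real.sinh (x / 2) : ℂ))⟫)

/-- **The pole form along the dilation orbit of a window function has derivative
`weilPoleResponse f` at `η = 0`.** [cite: Kato1966, VII §4 (forms depending on a parameter)] -/
theorem hasDerivAt_weilPoleForm_weilDilate {f : ℝ → ℂ} {b : ℝ} (hf : MemLp f 2)
    (hfs : ∀ x, b ≤ |x| → f x = 0) :
    HasDerivAt (fun η : ℝ ↦ weilPoleForm (weilDilate η f)) (weilPoleResponse f) 0 := by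
  have hc := hasDerivAt_integral_weilDilate_mul_kernel hf hfs (k := Real.cosh) (k' := Real.sinh)
    (fun y ↦ Real.hasDerivAt_cosh y) Real.continuous_sinh
  have hs := hasDerivAt_integral_weilDilate_mul_kernel hf hfs (k := Real.sinh) (k' := Real.cosh)
    (fun y ↦ Real.hasDerivAt_sinh y) Real.continuous_cosh
  have h := ((hc.norm_sq).const_mul 2).sub ((hs.norm_sq).const_mul 2)
  simp only [weilDilate_zero] at h
  unfold weilPoleForm weilPoleResponse
  exact h

/-! ## §3 The closed dilation virial -/

/-- The **closed dilation virial** of a window function `f`: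
`weilPoleResponse f − ∫₀^∞ (tρ)'(s) D_s(f) ds` (pole response minus archimedean virial). On test
functions of a window of radius `< ½ log 2` it is Bombieri's `weilDilationVirial`
(`weilDilationVirial_eq_weilFormVirial`); on ground states it is `weilSmallWindowVirial`
(`weilSmallWindowVirial_eq_weilFormVirial`); it is continuous along `L²`-convergent window sequences
(`tendsto_weilFormVirial_of_window`). [cite: Bombieri2000Weil, §4 proof of Thm 5 (the dilation)] -/
def weilFormVirial (f : ℝ → ℂ) : ℝ :=
  weilPoleResponse f - ∫ s in Ioi (0 : ℝ), weilArchVirialDensity s * weilIncrement f s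

/-- **The closed form along the dilation orbit is differentiable at `η = 0` with derivative the
closed virial**, for every `f ∈ L²` of finite archimedean energy vanishing at every `|x| ≥ b`,
`b < ½ log 2` (then no prime-power length lies below the support diameter and the prime part is
locally constant), read at any reference window `A`. [folklore] -/
theorem hasDerivAt_weilClosedForm_weilDilate {f : ℝ → ℂ} {b : ℝ} (A : ℝ)
    (hb : b < Real.log 2 / 2) (hf : MemLp f 2) (hfs : ∀ x, b ≤ |x| → f x = 0)
    (hE : IntegrableOn (fun t ↦ weilArchDensity t * weilIncrement f t) (Ioi 0)) :
    HasDerivAt (fun η : ℝ ↦ weilClosedForm A (weilDilate η f)) (weilFormVirial f) 0 := by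
  have hA : ∀ n ∈ weilPrimeIndex A, 2 ≤ n → 2 * b < Real.log n := fun n _ hn ↦ by
    have h2 : Real.log 2 ≤ Real.log n := Real.log_le_log two_pos (by exact_mod_cast hn)
    linarith
  have hP := hasDerivAt_weilPoleForm_weilDilate hf hfs
  have hPr := hasDerivAt_primeEnergy_weilDilate hf hfs hA
  have hAr := hasDerivAt_archEnergy_weilDilate hf hE
  have hM := hasDerivAt_mass_weilDilate f
  have e : (fun η : ℝ ↦ weilClosedForm A (weilDilate η f)) = fun η ↦
      weilPoleForm (weilDilate η f) +
      ((∑ n ∈ weilPrimeIndex A, (ArithmeticFunction.vonMangoldt n : ℝ) / Real.sqrt n *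
          weilIncrement (weilDilate η f) (Real.log n)) +
        ∫ t in Ioi (0 : ℝ), weilArchDensity t * weilIncrement (weilDilate η f) t) -
      weilMarkovConstant A * ∫ x, ‖weilDilate η f x‖ ^ 2 := by
    funext η
    rfl
  rw [e]
  refine ((hP.add (hPr.add hAr)).sub (hM.const_mul _)).congr_deriv ?_
  simp only [weilFormVirial]
  ring

/-- The open-window truncation of an `L²` function is in `L²`. [folklore] -/
theorem memLp_weilTrunc {a : ℝ} {u : ℝ → ℂ} (hu : MemLp u 2) : MemLp (weilTrunc a u) 2 := by
  unfold weilTrunc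
  exact hu.indicator measurableSet_Ioo

/-- **The small-window virial of a state is the closed virial of its truncation**:
`weilSmallWindowVirial a u = weilFormVirial (weilTrunc a u)` for every `u ∈ L²`. [folklore] -/
theorem weilSmallWindowVirial_eq_weilFormVirial {a : ℝ} {u : ℝ → ℂ} (hu : MemLp u 2) :
    weilSmallWindowVirial a u = weilFormVirial (weilTrunc a u) := by
  have hfs : ∀ x, a ≤ |x| → weilTrunc a u x = 0 := fun x hx ↦ weilTrunc_eq_zero u hx
  unfold weilSmallWindowVirial weilFormVirial
  rw [(hasDerivAt_weilPoleForm_weilDilate (memLp_weilTrunc hu) hfs).deriv]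

/-- **On test functions of a window of radius `< ½ log 2` the closed virial is Bombieri's dilation
virial** `weilDilationVirial g = Re W(D(g ⋆ g̃))`: both are the derivative at `η = 0` of the closed
form along the dilation orbit (`hasDerivAt_weilDilationProfile_of_isWeilTest`,
`hasDerivAt_weilClosedForm_weilDilate`). So `weilFormVirial` is the closed extension of the virial
from `C_c^∞` to the form domain. [cite: Bombieri2000Weil, §4 proof of Thm 5 (the dilation)] -/
theorem weilDilationVirial_eq_weilFormVirial {g : ℝ → ℂ} (hg : IsWeilTest g) {b : ℝ}
    (hb0 : 0 < b) (hb : b < Real.log 2 / 2) (hsupp : tsupport g ⊆ Icc (-b) b) :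
    weilDilationVirial g = weilFormVirial g := by
  have h1 := hasDerivAt_weilDilationProfile_of_isWeilTest hg hb0 hsupp
  have hgs : ∀ x, b ≤ |x| → g x = 0 := fun x hx ↦
    eq_zero_of_le_abs_of_tsupport_subset hg hsupp hx
  have h2 := hasDerivAt_weilClosedForm_weilDilate (2 * b) hb hg.memLp_two hgs
    (integrableOn_weilArchDensity_mul_weilIncrement hg)
  have e : weilDilationProfile b g = fun η ↦ weilClosedForm (2 * b) (weilDilate η g) := by
    funext η
    show weilClosedForm (2 * b) (weilDilate η (weilTrunc b g)) = _
    rw [weilTrunc_eq_self hgs]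
  rw [e] at h1
  exact h1.unique h2

/-! ## §4 Continuity along `L²`-convergent window sequences -/

/-- **The pole response is continuous along `L²`-convergent sequences on a fixed window** (the four
pairings have continuous weights). [folklore] -/
theorem tendsto_weilPoleResponse_of_window {R : ℝ} {f : ℝ → ℂ} {g : ℕ → ℝ → ℂ} (hf : MemLp f 2)
    (hg : ∀ n, MemLp (g n) 2) (hfR : ∀ x, x ∉ Icc (-R) R → f x = 0)
    (hgR : ∀ n x, x ∉ Icc (-R) R → g n x = 0)
    (hlim : Tendsto (fun n ↦ ∫ x, ‖g n x - f x‖ ^ 2) atTop (𝓝 0)) :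
    Tendsto (fun n ↦ weilPoleResponse (g n)) atTop (𝓝 (weilPoleResponse f)) := by
  have hA := tendsto_integral_mul_ofReal_of_window hf hg hfR hgR hlim
    (w := fun x ↦ Real.cosh (x / 2)) (by fun_prop)
  have hB := tendsto_integral_mul_ofReal_of_window hf hg hfR hgR hlim
    (w := fun x ↦ Real.sinh (x / 2)) (by fun_prop)
  have hA' := tendsto_integral_mul_ofReal_of_window hf hg hfR hgR hlim
    (w := fun x ↦ -(x / 2) * Real.sinh (x / 2)) (by fun_prop)
  have hB' := tendsto_integral_mul_ofReal_of_window hf hg hfR hgR hlim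
    (w := fun x ↦ -(x / 2) * Real.cosh (x / 2)) (by fun_prop)
  unfold weilPoleResponse
  exact (((hA.inner (𝕜 := ℝ) (hA'.sub (hA.const_mul (1 / 2 : ℂ)))).const_mul (2 : ℝ)).const_mul
    (2 : ℝ)).sub (((hB.inner (𝕜 := ℝ) (hB'.sub (hB.const_mul (1 / 2 : ℂ)))).const_mul
      (2 : ℝ)).const_mul (2 : ℝ))

/-- **The closed virial is continuous along `L²`-convergent sequences on a fixed window with
bounded norms**: pole response by `tendsto_weilPoleResponse_of_window`; archimedean virial by
dominated convergence (`D_s(gₙ) → D_s(f)` for every `s`, `|(tρ)'(s)| D_s(gₙ) ≤ C e^{-s/4} · 4N`).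
[folklore] -/
theorem tendsto_weilFormVirial_of_window {R N : ℝ} {f : ℝ → ℂ} {g : ℕ → ℝ → ℂ} (hf : MemLp f 2)
    (hg : ∀ n, MemLp (g n) 2) (hfR : ∀ x, x ∉ Icc (-R) R → f x = 0)
    (hgR : ∀ n x, x ∉ Icc (-R) R → g n x = 0) (hN : ∀ n, ∫ x, ‖g n x‖ ^ 2 ≤ N)
    (hlim : Tendsto (fun n ↦ ∫ x, ‖g n x - f x‖ ^ 2) atTop (𝓝 0)) :
    Tendsto (fun n ↦ weilFormVirial (g n)) atTop (𝓝 (weilFormVirial f)) := by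
  refine (tendsto_weilPoleResponse_of_window hf hg hfR hgR hlim).sub ?_
  obtain ⟨C, hC, hCb⟩ := exists_abs_weilArchVirialDensity_le
  have hN0 : 0 ≤ N := le_trans (integral_nonneg fun x ↦ by positivity) (hN 0)
  refine tendsto_integral_filter_of_dominated_convergence
    (fun s ↦ C * Real.exp (-(1 / 4) * s) * (4 * N)) ?_ ?_ ?_ ?_
  · exact Eventually.of_forall fun n ↦
      ((measurable_weilArchVirialDensity.aestronglyMeasurable.mul
        (stub_localizedCut_aesm_weilIncrement (hg n).1)).restrict)
  · refine Eventually.of_forall fun n ↦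
      (ae_restrict_iff' measurableSet_Ioi).2 (Eventually.of_forall fun s hs ↦ ?_)
    have hs0 : (0 : ℝ) < s := hs
    have hD0 : 0 ≤ weilIncrement (g n) s := weilIncrement_nonneg _ _
    have hD4 : weilIncrement (g n) s ≤ 4 * N :=
      (stub_barrierEnergy_weilIncrement_le_four (hg n) s).trans (by linarith [hN n])
    rw [Real.norm_eq_abs, abs_mul, abs_of_nonneg hD0]
    have h1 : |weilArchVirialDensity s| ≤ C * Real.exp (-(1 / 4) * s) := by
      rw [show -(1 / 4) * s = -(s / 4) by ring]
      exact hCb s hs0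
    exact mul_le_mul h1 hD4 hD0 (by positivity)
  · exact (((exp_neg_integrableOn_Ioi 0 (by norm_num : (0 : ℝ) < 1 / 4)).const_mul C).mul_const
      (4 * N))
  · refine (ae_restrict_iff' measurableSet_Ioi).2 (Eventually.of_forall fun s _ ↦ ?_)
    exact (tendsto_weilIncrement_of_tendsto hf hg hlim s).const_mul _

end Summit.RiemannHypothesis.RiemannHypothesis.Theorems.PfPersistence

end
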